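import Summits.QuantumFields.YangMills.Theorems.UnitScaleTiltProp7PinnedKernelL1Rows
import HarnessLib

/-!
# Route `UnitScaleTilt`, crux K1 «MinimiserStabilityRegPr» (stmt-QuantumFields-19200), route-R E′ path (α′), residue (hK), assembly (A), file (F-a, part 2 of 2):
# THE INSTANTIATION WITH EVERY NUMBER EXPLICIT — on the finest torus `Site P 0` (`d = 3`), for the split pinned-biharmonic Green matrix `G = Gf − Uf` of
# ✓ `Prop7GreenKernelSiteFree.exists_green_site_split_free` and every bond `b`, the ℓ¹ mass `Σ_z|Δ_c((Gf b₊ − Gf b₋) − (Uf b₊ − Uf b₋))(z)|` (`= |c|⁻¹Σ_z|K(b,z)|` of ✓p654411)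
# is bounded by an EXPLICIT expression in `ℓ = L^k`, `c`, the Agmon rate `κ`, the (R2) constant `C_V` and four absolute Green-function constants — the seven numbers of the
# (A-door) ✓ `sum_abs_laplace_sub_interp_le_of_rows` read from the bricks (S) ✓p663986, (U) ✓p664410, (Gm) ✓p664882, (N) `…PinnedKernelNearField`, (I-site) ✓p663513

Cell `ym3-torus`, width seat `ym3-torus-px22` (gen 2) = the (A)-instantiation seat (★routeR-w3 g5 19:59:56Z); LOCATE 19200 evidence `LOCATE-A3-FARFIELD-px22g2.md` v1.2.
`--supports stmt-QuantumFields-19200`, count-neutral.  THEOREMS ONLY (0 `def`, 0 `sorry`).  YM₃ on T³ is a ladder rung (R3), not the Clay problem; nothing here claims the stub, the crux,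
d = 4 or the gap.

DISPLAYED (and discharged in the follow-up (F-b)): the rate `κ` with `0 < κ`, `2κ∕ℓ ≤ 1∕2`, `κ ≤ 1` and the two ℓ-FREE window rows of ✓ `weighted_laplace_le_window` in raw form; the (R2) row
`|G₂(t+eᵢ) − G₂(t)| ≤ C_V` in ✓p662426's displayed-`G₂` currency (px13's part B); the size `40 ≤ sitesPerDir k` (so the near-field ball does not wrap); `1 ≤ k`.  Everything else is a landed decl:
(D1-glob) ✓p658748, (W1) ✓p660013, (W2) ✓p659352, (W3-lite) ✓p660942, (R5)∕(R5c) ✓ `Prop7GreenKernelSiteRows`∕`SiteFree`, (R4) ✓px7, (Hess3) ✓p661087, (R3a) ✓p662426, (EL-loc) ✓p662444,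
(A-door) ✓p663210.

WHAT IS PROVED (ns `…Theorems.Prop7PinnedKernelL1Explicit`).
* ★★★ `sum_abs_laplace_kernel_le_explicit` — the explicit bound (statement = the (A-door)'s right-hand side with the seven numbers substituted; see the docstring for the reading).
HONEST SCOPE.  Plumbing; the scale reading `≍ ℓ∕c²` (⇒ `Σ_z|K(b,z)| ≤ c_I·ℓ`) and the choice `κ := κ₀` are the next file.

References: T. Bałaban, CMP 96 (1984) 223–250 [Balaban1984PropagatorsII] ((1.9) p.226, (2.61) p.234); CMP 99 (1985) 75–102 [Balaban1985RegularSpaces] ((1.14) p.78, (1.36) p.82);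
CMP 102 (1985) 277–309 [Balaban1985Variational] (Prop. 7 p.299).
-/

set_option autoImplicit false

noncomputable section

open scoped BigOperators

namespace Summit.QuantumFields.YangMills.Theorems.Prop7PinnedKernelL1Explicit

open Literature.MathematicalPhysics.QuantumFieldTheory.Balaban1983to89
open Finset LatticeFieldCalculus
open B15DeterminingSets (embIter)
open B5Eq117TorusCarriers (EK)
open Literature.Probability.LatticeModels (torusGreen TorusSite latticeMomentum dispersion)
open B3Taylor310LocalRemainder (tdist_comm tdist_self tdist_triangle)
open Summit.QuantumFields.YangMills.Theorems.Prop7CentreHarmonicInterpKernel (laplace_sub')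
open Summit.QuantumFields.YangMills.Theorems.Prop7PinnedBiharmonicAgmonDecay (poincare_root_of_sq)
open Summit.QuantumFields.YangMills.Theorems.Prop7TorusAgmonWeight (exists_admissible_weight exists_scale_cutoff)
open Summit.QuantumFields.YangMills.Theorems.Prop7TorusExpWeightSum (sum_exp_neg_mul_tdist_le)
open Summit.QuantumFields.YangMills.Theorems.Prop7PinnedKernelL1OfRows (sum_abs_laplace_sub_interp_le_of_rows)
open Summit.QuantumFields.YangMills.Theorems.Prop7PinnedGreenSymmetry (exists_pinned_interp_of_green)
open Summit.QuantumFields.YangMills.Theorems.Prop7PinnedKernelSources (sqrt_sum_sq_weighted_h_le sqrt_sum_sq_weighted_ht_le sqrt_sum_sq_weighted_s_le sum_abs_laplace_mul_le)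
open Summit.QuantumFields.YangMills.Theorems.Prop7PinnedKernelBumps (bump_ext_apply_centre sum_abs_laplace_bump_ext_le sqrt_sum_sq_weighted_laplace_bump_ext_le)
open Summit.QuantumFields.YangMills.Theorems.Prop7PinnedKernelGeometry (locally_const_off_annulus card_annulus_le card_filter_tdist_lt_le pow_le_tdist_embIter_of_ne
  exists_bump_family exists_delta_family tdist_shift_le_add_one tdist_le_tdist_shift_add_one tdist_unshift_le_add_one tdist_le_tdist_unshift_add_one)
open Summit.QuantumFields.YangMills.Theorems.Prop7PinnedKernelNearField (sum_abs_mul_near_le abs_g_mul_tdist_sq_le abs_g_shift_sub_g_mul_tdist_cube_le)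
open Summit.QuantumFields.YangMills.Theorems.Prop7GreenKernelSiteRows (abs_free_sub_free_le_of_grad_bound exists_grad_free_sub_free_const tdist_sq_le_card_mul_sum_sq)
open Summit.QuantumFields.YangMills.Theorems.Prop7CentrePinnedHessianPoincare (sum_sq_le_laplace_sq_of_vanish_on_range)

variable {P : Params}

open Summit.QuantumFields.YangMills.Theorems.Prop7PinnedKernelL1Rows

/-! ## §2 ★★★ The explicit kernel bound -/

set_option maxHeartbeats 400000 in
/-- ★★★ **THE (hK) KERNEL BOUND WITH EVERY NUMBER EXPLICIT.**  `P.d = 3`, `1 ≤ k ≤ m + K`, `ℓ := L^k`, `ℓ₀ := 2ℓ`, lattice factor `c ≠ 0`, `40 ≤ sitesPerDir k`; the split Green matrix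
`G = Gf − Uf` of ✓ `exists_green_site_split_free` (its rows DISPLAYED as hypotheses on `Gf Uf G`, with the `Gf`-formula through the displayed `G₂`); the (R2) row `|G₂(t+eᵢ) − G₂ t| ≤ C_V`;
an Agmon rate `κ` with `0 < κ ≤ 1`, `2κ∕ℓ ≤ 1∕2` and the two raw window rows.  Then for every bond `b`, with `V := Gf b₊ − Gf b₋`, `U := Uf b₊ − Uf b₋`:
`Σ_z|Δ_c(V − U)(z)| ≤ W·(3Nh + 5√A·Nht + 5A·Ns) + N₂ + N₃ + W·(3N₄)` where, writing `Ω := e^{κ(1+(5√dℓ₀+1)∕ℓ)}`, `Ω_u := e^{κ(1+(5√dℓ₀+ℓ+1)∕ℓ)}`, `N_T := (2(⌈5√dℓ₀⌉₊+1))^d`,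
`N_u := (2(⌈5√dℓ₀+ℓ⌉₊+1))^d`, `C₁ := 3∕(2ℓ₀)`, `C₂ := 9∕ℓ₀²`, `D₀ := C_V∕(4c⁴)`, `D₁ := 2C_H√d∕(4c⁴(ℓ₀−2))`, `Dg := d|(2c²)⁻¹|C_N∕(ℓ₀−2)²`, `Dg′ := d√d|(2c²)⁻¹|C_{H1}∕(ℓ₀−3)³`,
`B := 13dc²(10√d+4)²∕ℓ²`, `A := √(C_G∕c⁴)·ℓ²`:  `W = √((2(1+(4κ∕(π√dℓ))⁻¹))^d)`, `Nh = Ω·d·c²(C₁D₁+C₂D₀)·√N_T`, `Nht = Ω·Dg|c|C₁·√(dN_T)`, `Ns = Ω·d|c|C₁|c|Dg′·√N_T`,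
`N₂ = |(2c²)⁻¹|C_R(⌈5√dℓ₀⌉₊+1) + N_T·dc²(C₁D₁+C₂D₀)`, `N₃ = N_u·D₀B`, `N₄ = Ω_u·D₀B·√N_u` — every symbol `≍` its (A-door) scale (`W ≍ ℓ^{3∕2}`, `Nh,N₄ ≍ ℓ^{−1∕2}c⁻²`, …), so the
right-hand side is `≍ ℓ∕c²` and `Σ_z|K(b,z)| = |c|·(lhs) ≍ ℓ∕|c|` (next file).  The four absolute constants `C_R, C_N, C_{H1}, C_H ≥ 0` are ✓px7's near field, ✓p659194, ✓p661087, ✓p662426.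
[cite: Balaban1984PropagatorsII, (1.9) p.226, (2.61) p.234; Balaban1985RegularSpaces, (1.36) p.82; Balaban1985Variational, Prop. 7 p.299] -/
theorem sum_abs_laplace_kernel_le_explicit : ∃ CR CN CH1 CH : ℝ, 0 ≤ CR ∧ 0 ≤ CN ∧ 0 ≤ CH1 ∧ 0 ≤ CH ∧
    ∀ (P : Params) (hd : P.d = 3) (k : ℕ) (hk : k ≤ P.m + P.K) (_ : 1 ≤ k) (c : ℝ) (hc : c ≠ 0) (_ : 40 ≤ P.sitesPerDir k)
      (G₂ : TorusSite P.d (P.L ^ k * P.sitesPerDir k) → ℝ)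
      (_ : ∀ t : TorusSite P.d (P.L ^ k * P.sitesPerDir k),
        G₂ t = (∑ q ∈ (univ : Finset (TorusSite P.d (P.L ^ k * P.sitesPerDir k))).erase 0,
          Real.cos (∑ i, latticeMomentum (P.L ^ k * P.sitesPerDir k) q i * ((t i).val : ℝ))
            / dispersion (latticeMomentum (P.L ^ k * P.sitesPerDir k) q) ^ 2)
          / (((P.L ^ k * P.sitesPerDir k : ℕ) : ℝ)) ^ P.d)
      (CV : ℝ) (_ : 0 ≤ CV) (_ : ∀ (i : Fin P.d) (t : TorusSite P.d (P.L ^ k * P.sitesPerDir k)), |G₂ (t + Pi.single i 1) - G₂ t| ≤ CV)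
      (Gf Uf G : Site P 0 → Site P 0 → ℝ)
      (_ : ∀ x z, G x z = Gf x z - Uf x z)
      (_ : ∀ x (y : Site P k), Uf x (embIter k y) = Gf x (embIter k y))
      (_ : ∀ x, ∀ y ∈ Set.range (embIter (P := P) k), G x y = 0)
      (_ : ∀ x z, z ∉ Set.range (embIter (P := P) k) → laplace c (laplace c (Uf x)) z = 0)
      (_ : ∀ x z, laplace c (Gf x) z = (2 * c ^ 2)⁻¹ *
          (torusGreen (L := P.L ^ k * P.sitesPerDir k) (EK hk z - EK hk x)
            - torusGreen (L := P.L ^ k * P.sitesPerDir k) (EK hk z - EK hk (embIter k default))))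
      (_ : ∀ x z, laplace c (laplace c (Gf x)) z = (if z = x then (1 : ℝ) else 0) - (if z = embIter k default then (1 : ℝ) else 0))
      (_ : ∀ x z, Gf x z = (4 * c ^ 4)⁻¹ * (G₂ (EK hk z - EK hk x) - G₂ (EK hk z - EK hk (embIter k default))))
      (_ : ∀ e : SiteField P 0 ℝ, (∀ y ∈ Set.range (embIter (P := P) k), e y = 0) → ∀ x, e x = ∑ z, G x z * laplace c (laplace c e) z)
      (κ : ℝ) (_ : 0 < κ) (_ : κ ≤ 1) (_ : 2 * κ / (P.L : ℝ) ^ k ≤ 1 / 2)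
      (_ : 2 * κ / (P.L : ℝ) ^ k * |c| * Real.sqrt P.d * Real.sqrt (Real.sqrt ((2197 * (24 * 289 * 24576 * 46116) : ℝ) / c ^ 4) * ((P.L : ℝ) ^ k) ^ 2) ≤ 1 / 100)
      (_ : 4 * κ / ((P.L : ℝ) ^ k) ^ 2 * c ^ 2 * P.d * (Real.sqrt ((2197 * (24 * 289 * 24576 * 46116) : ℝ) / c ^ 4) * ((P.L : ℝ) ^ k) ^ 2) ≤ 1 / 50)
      (b : PBond P 0),
      ∑ z, |laplace c (fun x => (Gf b.tgt x - Gf b.src x) - (Uf b.tgt x - Uf b.src x)) z|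
        ≤ Real.sqrt ((2 * (1 + 1 / (4 * κ / (Real.pi * Real.sqrt P.d * (P.L : ℝ) ^ k)))) ^ P.d)
            * (3 * (Real.exp (κ * (1 + (5 * Real.sqrt P.d * (2 * (P.L : ℝ) ^ k) + 1) / (P.L : ℝ) ^ k))
                      * (P.d * (c ^ 2 * (3 / (2 * (2 * (P.L : ℝ) ^ k)) * (2 * (CH / (4 * c ^ 4) * Real.sqrt P.d) / (2 * (P.L : ℝ) ^ k - 2))
                        + 9 / (2 * (P.L : ℝ) ^ k) ^ 2 * (CV / (4 * c ^ 4)))))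
                      * Real.sqrt ((2 * (⌈5 * Real.sqrt P.d * (2 * (P.L : ℝ) ^ k)⌉₊ + 1)) ^ P.d : ℕ))
                + 5 * Real.sqrt (Real.sqrt ((2197 * (24 * 289 * 24576 * 46116) : ℝ) / c ^ 4) * ((P.L : ℝ) ^ k) ^ 2)
                    * (Real.exp (κ * (1 + (5 * Real.sqrt P.d * (2 * (P.L : ℝ) ^ k) + 1) / (P.L : ℝ) ^ k))
                      * (P.d * (|(2 * c ^ 2)⁻¹| * CN) / (2 * (P.L : ℝ) ^ k - 2) ^ 2 * (|c| * (3 / (2 * (2 * (P.L : ℝ) ^ k)))))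
                      * Real.sqrt (P.d * ((2 * (⌈5 * Real.sqrt P.d * (2 * (P.L : ℝ) ^ k)⌉₊ + 1)) ^ P.d : ℕ)))
                + 5 * (Real.sqrt ((2197 * (24 * 289 * 24576 * 46116) : ℝ) / c ^ 4) * ((P.L : ℝ) ^ k) ^ 2)
                    * (Real.exp (κ * (1 + (5 * Real.sqrt P.d * (2 * (P.L : ℝ) ^ k) + 1) / (P.L : ℝ) ^ k))
                      * (P.d * (|c| * (3 / (2 * (2 * (P.L : ℝ) ^ k))) * (|c| * (P.d * Real.sqrt P.d * (|(2 * c ^ 2)⁻¹| * CH1) / (2 * (P.L : ℝ) ^ k - 3) ^ 3))))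
                      * Real.sqrt ((2 * (⌈5 * Real.sqrt P.d * (2 * (P.L : ℝ) ^ k)⌉₊ + 1)) ^ P.d : ℕ)))
          + (|(2 * c ^ 2)⁻¹| * (CR * ((⌈5 * Real.sqrt P.d * (2 * (P.L : ℝ) ^ k)⌉₊ : ℝ) + 1))
              + ((2 * (⌈5 * Real.sqrt P.d * (2 * (P.L : ℝ) ^ k)⌉₊ + 1)) ^ P.d : ℕ)
                * (P.d * (c ^ 2 * (3 / (2 * (2 * (P.L : ℝ) ^ k)) * (2 * (CH / (4 * c ^ 4) * Real.sqrt P.d) / (2 * (P.L : ℝ) ^ k - 2))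
                  + 9 / (2 * (P.L : ℝ) ^ k) ^ 2 * (CV / (4 * c ^ 4))))))
          + ((2 * (⌈5 * Real.sqrt P.d * (2 * (P.L : ℝ) ^ k) + (P.L : ℝ) ^ k⌉₊ + 1)) ^ P.d : ℕ)
              * (CV / (4 * c ^ 4) * (13 * P.d * c ^ 2 * (10 * Real.sqrt P.d + 4) ^ 2 / ((P.L : ℝ) ^ k) ^ 2))
          + Real.sqrt ((2 * (1 + 1 / (4 * κ / (Real.pi * Real.sqrt P.d * (P.L : ℝ) ^ k)))) ^ P.d)
              * (3 * (Real.exp (κ * (1 + (5 * Real.sqrt P.d * (2 * (P.L : ℝ) ^ k) + (P.L : ℝ) ^ k + 1) / (P.L : ℝ) ^ k))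
                  * (CV / (4 * c ^ 4) * (13 * P.d * c ^ 2 * (10 * Real.sqrt P.d + 4) ^ 2 / ((P.L : ℝ) ^ k) ^ 2))
                  * Real.sqrt ((2 * (⌈5 * Real.sqrt P.d * (2 * (P.L : ℝ) ^ k) + (P.L : ℝ) ^ k⌉₊ + 1)) ^ P.d : ℕ))) := by
  classical
  obtain ⟨CR, hCR0, hCR⟩ := sum_abs_mul_near_le
  obtain ⟨CN₀, hCN₀⟩ := abs_g_mul_tdist_sq_le
  obtain ⟨CH1₀, hCH1₀⟩ := abs_g_shift_sub_g_mul_tdist_cube_le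
  obtain ⟨CH₀, hCH₀⟩ := exists_grad_free_sub_free_const
  -- nonnegative versions of the three pointwise constants
  set CN : ℝ := max CN₀ 0 with hCN
  set CH1 : ℝ := max CH1₀ 0 with hCH1
  set CH : ℝ := max CH₀ 0 with hCHdef
  refine ⟨CR, CN, CH1, CH, hCR0, le_max_right _ _, le_max_right _ _, le_max_right _ _, ?_⟩
  intro P hd k hk hk1 c hc hM G₂ hG₂ CV hCV hV2 Gf Uf G hsplit hUC hG0 hUel hGf1 hGf2 hGfF hGrep κ hκ0 hκ1 ha hwin₁ hwin₂ b
  -- NOTATION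
  haveI hNZ : NeZero (P.L ^ k * P.sitesPerDir k) := ⟨mul_ne_zero (pow_ne_zero _ P.L_pos.ne') (P.sitesPerDir_ne_zero k)⟩
  set ℓ : ℝ := (P.L : ℝ) ^ k with hℓ
  set ℓ₀ : ℝ := 2 * ℓ with hℓ₀
  have hL3 : 3 ≤ P.L := by
    have h1 := P.hL.2; have h2 := P.hL.1
    rcases h2 with ⟨m, hm⟩; omega
  have hℓ3n : 3 ≤ P.L ^ k := by
    calc 3 ≤ P.L := hL3
      _ = P.L ^ 1 := (pow_one _).symm
      _ ≤ P.L ^ k := Nat.pow_le_pow_right P.L_pos hk1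
  have hℓ3 : (3 : ℝ) ≤ ℓ := by rw [hℓ]; exact_mod_cast hℓ3n
  have hℓ1 : (1 : ℝ) ≤ ℓ := by linarith
  have hℓ0 : 0 < ℓ := by linarith
  have hd3 : (P.d : ℝ) = 3 := by rw [hd]; norm_num
  have hsd : 0 ≤ Real.sqrt P.d := Real.sqrt_nonneg _
  have hd0 : (0 : ℝ) ≤ P.d := Nat.cast_nonneg _
  set C : Set (Site P 0) := Set.range (embIter (P := P) k) with hCdef
  -- THE OBJECTS
  set V : SiteField P 0 ℝ := fun z => Gf b.tgt z - Gf b.src z with hVdef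
  set U : SiteField P 0 ℝ := fun z => Uf b.tgt z - Uf b.src z with hUdef
  set g : SiteField P 0 ℝ := fun z => (2 * c ^ 2)⁻¹ * (torusGreen (L := P.L ^ k * P.sitesPerDir k) (EK hk z - EK hk b.tgt)
    - torusGreen (L := P.L ^ k * P.sitesPerDir k) (EK hk z - EK hk b.src)) with hgdef
  set f : SiteField P 0 ℝ := fun z => (if z = b.tgt then (1 : ℝ) else 0) - (if z = b.src then (1 : ℝ) else 0) with hfdef
  have hg : laplace c V = g := by
    funext z
    rw [hVdef, laplace_sub']
    dsimp only
    rw [hGf1 b.tgt z, hGf1 b.src z, hgdef]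
    ring
  have hf : laplace c g = f := by
    rw [← hg]
    funext z
    rw [hVdef, laplace_sub', laplace_sub']
    dsimp only
    rw [hGf2 b.tgt z, hGf2 b.src z, hfdef]
    dsimp only
    ring
  have hUC' : ∀ x ∈ C, U x = V x := by
    rintro x ⟨y, rfl⟩
    simp only [hUdef, hVdef, hUC]
  have hUel' : ∀ x ∉ C, laplace c (laplace c U) x = 0 := by
    intro x hx
    rw [hUdef, laplace_sub', laplace_sub']
    dsimp only
    rw [hUel b.tgt x hx, hUel b.src x hx, sub_zero]
  -- THE CUTOFF `χ₀` (scale `ℓ₀ = 2ℓ`, base `b₋`)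
  have hℓ₀1 : 1 ≤ ℓ₀ := by rw [hℓ₀]; linarith
  obtain ⟨χ, hχ01, hχin, hχout, hχd1, hχd2, -, -⟩ := exists_scale_cutoff (P := P) (j := 0) b.src hℓ₀1
  have hχabs : ∀ z, |χ z| ≤ 1 := fun z => by rw [abs_le]; constructor <;> linarith [(hχ01 z).1, (hχ01 z).2]
  have hχf : ∀ x, (1 - χ x) * f x = 0 := by
    intro x
    by_cases hx : x = b.tgt ∨ x = b.src
    · have hdist : (Site.tdist x b.src : ℝ) ≤ ℓ₀ := by
        rcases hx with rfl | rfl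
        · have h1 : Site.tdist b.tgt b.src ≤ 1 := by
            rw [tdist_comm]; exact Summit.QuantumFields.Balaban3D.Proofs.Run3Collar.tdist_shift_le b.src b.dir
          have : (Site.tdist b.tgt b.src : ℝ) ≤ 1 := by exact_mod_cast h1
          linarith
        · rw [tdist_self]; push_cast; linarith
      rw [hχin x hdist]; ring
    · push Not at hx
      simp only [hfdef, if_neg hx.1, if_neg hx.2, sub_zero, mul_zero]
  -- THE ANNULUS `T` and local constancy
  set T : Finset (Site P 0) := Finset.univ.filter fun z : Site P 0 => ℓ₀ - 1 < (Site.tdist z b.src : ℝ) ∧ (Site.tdist z b.src : ℝ) < 5 * Real.sqrt P.d * ℓ₀ + 1 with hTdef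
  have hχT : ∀ z ∉ T, ∀ μ, χ (z.shift μ) = χ z ∧ χ (z.unshift μ) = χ z := locally_const_off_annulus χ b.src hχin hχout
  have hTmem : ∀ z ∈ T, ℓ₀ - 1 < (Site.tdist z b.src : ℝ) := fun z hz => by
    rw [hTdef, Finset.mem_filter] at hz; exact hz.2.1
  have hTmem' : ∀ z ∈ T, (Site.tdist z b.src : ℝ) < 5 * Real.sqrt P.d * ℓ₀ + 1 := fun z hz => by
    rw [hTdef, Finset.mem_filter] at hz; exact hz.2.2
  have hTcard : (T.card : ℝ) ≤ ((2 * (⌈5 * Real.sqrt P.d * ℓ₀⌉₊ + 1)) ^ P.d : ℕ) := by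
    exact_mod_cast card_annulus_le b.src (ℓ₀) (5 * Real.sqrt P.d * ℓ₀)
  -- THE ROWS ON `T`
  -- (R5c) sup: `|V w| ≤ D₀`
  have hV0 : ∀ w, |V w| ≤ CV / (4 * c ^ 4) := by
    intro w
    have h := abs_free_sub_free_le_of_grad_bound hk hc G₂ hV2 Gf (embIter k default) hGfF b.src b.dir w
    rw [show b.src.shift b.dir = b.tgt from rfl] at h
    simpa only [hVdef] using h
  -- (R5c) gradient ⇒ the symmetric-difference row on the annulus
  have hCH0 : 0 ≤ CH := le_max_right _ _
  have hc4 : 0 < 4 * c ^ 4 := by positivity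
  have hV1 : ∀ z (ν : Fin P.d), z ≠ b.src → |V (z.shift ν) - V z| * Real.sqrt (∑ q, ((((EK hk z - EK hk b.src) q).valMinAbs : ℤ) : ℝ) ^ 2) ≤ CH / (4 * c ^ 4) := by
    intro z ν hz
    have h := hCH₀ P hd k hk c hc G₂ hG₂ Gf (embIter k default) hGfF b.src b.dir z ν hz
    have h' : CH₀ / (4 * c ^ 4) ≤ CH / (4 * c ^ 4) := div_le_div_of_nonneg_right (le_max_left _ _) hc4.le
    rw [show b.src.shift b.dir = b.tgt from rfl] at h
    simp only [hVdef]
    exact h.trans h'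
  have hℓ₀3 : 3 ≤ ℓ₀ := by rw [hℓ₀]; linarith
  have hℓ₀4 : 4 ≤ ℓ₀ := by rw [hℓ₀]; linarith
  have hV₁T : ∀ z ∈ T, ∀ μ, |V (z.shift μ) - V (z.unshift μ)| ≤ 2 * (CH / (4 * c ^ 4) * Real.sqrt P.d) / (ℓ₀ - 2) :=
    fun z hz μ => abs_symmDiff_le_of_grad_row hk b V (by positivity) hℓ₀3 hV1 z (hTmem z hz) μ
  have hV₀T : ∀ z ∈ T, ∀ μ, |V (z.unshift μ)| ≤ CV / (4 * c ^ 4) := fun z _ μ => hV0 _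
  -- the free-kernel rows `Dg`, `Dg′` on `T`
  have hCN0 : 0 ≤ CN := le_max_right _ _
  have hCH10 : 0 ≤ CH1 := le_max_right _ _
  have hgform : ∀ z, g z = (2 * c ^ 2)⁻¹ * (torusGreen (L := P.L ^ k * P.sitesPerDir k) (EK hk z - EK hk b.tgt)
      - torusGreen (L := P.L ^ k * P.sitesPerDir k) (EK hk z - EK hk b.src)) := fun z => rfl
  have hgrow : ∀ z, z ≠ b.tgt → |g z| * (Site.tdist z b.tgt : ℝ) ^ 2 ≤ P.d * (|(2 * c ^ 2)⁻¹| * CN) := by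
    intro z hz
    exact (hCN₀ P hd k hk c b g hgform z hz).trans
      (mul_le_mul_of_nonneg_left (mul_le_mul_of_nonneg_left (le_max_left _ _) (abs_nonneg _)) hd0)
  have hgrow' : ∀ z (ν : Fin P.d), z.shift ν ≠ b.tgt → |g (z.shift ν) - g z| * (Site.tdist (z.shift ν) b.tgt : ℝ) ^ 3
      ≤ P.d * Real.sqrt P.d * (|(2 * c ^ 2)⁻¹| * CH1) := by
    intro z ν hz
    exact (hCH1₀ P hd k hk c b g hgform z ν hz).trans
      (mul_le_mul_of_nonneg_left (mul_le_mul_of_nonneg_left (le_max_left _ _) (abs_nonneg _)) (by positivity))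
  have hgT : ∀ z ∈ T, |g z| ≤ P.d * (|(2 * c ^ 2)⁻¹| * CN) / (ℓ₀ - 2) ^ 2 :=
    fun z hz => abs_g_le_of_row b g hℓ₀3 hgrow z (hTmem z hz)
  have hg₁T : ∀ z ∈ T, ∀ μ, |g (z.shift μ) - g z| ≤ P.d * Real.sqrt P.d * (|(2 * c ^ 2)⁻¹| * CH1) / (ℓ₀ - 3) ^ 3 :=
    fun z hz μ => abs_g_diff_le_of_row b g hℓ₀4 hgrow' z (hTmem z hz) μ
  -- THE WEIGHT (W1) at base `b₋`, scale `ℓ`, rate `κ`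
  obtain ⟨ω, hω₀, hω₁, hω₂, hωlo, hωhi⟩ := exists_admissible_weight (P := P) (j := 0) b.src hℓ1 hκ0.le hκ1
  have hω0' : ∀ z, 0 ≤ ω z := fun z => (hω₀ z).le
  set Ω : ℝ := Real.exp (κ * (1 + (5 * Real.sqrt P.d * ℓ₀ + 1) / ℓ)) with hΩ
  have hΩ0 : 0 ≤ Ω := (Real.exp_pos _).le
  have hωT : ∀ z ∈ T, ω z ≤ Ω := by
    intro z hz
    refine (hωhi z).trans (Real.exp_le_exp.mpr (mul_le_mul_of_nonneg_left ?_ hκ0.le))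
    have := hTmem' z hz
    have : (Site.tdist z b.src : ℝ) / ℓ ≤ (5 * Real.sqrt P.d * ℓ₀ + 1) / ℓ := div_le_div_of_nonneg_right this.le hℓ0.le
    linarith
  -- THE THREE SOURCE NUMBERS (brick (S))
  have hC₁0 : (0 : ℝ) ≤ 3 / (2 * ℓ₀) := by positivity
  have hC₂0 : (0 : ℝ) ≤ 9 / ℓ₀ ^ 2 := by positivity
  have hD₀0 : 0 ≤ CV / (4 * c ^ 4) := by positivity
  have hℓ20 : 0 < ℓ₀ - 2 := by rw [hℓ₀]; linarith
  have hℓ30 : 0 < ℓ₀ - 3 := by rw [hℓ₀]; linarith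
  have hD₁0 : 0 ≤ 2 * (CH / (4 * c ^ 4) * Real.sqrt P.d) / (ℓ₀ - 2) := by positivity
  have hDg0 : 0 ≤ P.d * (|(2 * c ^ 2)⁻¹| * CN) / (ℓ₀ - 2) ^ 2 := by positivity
  have hDg'0 : 0 ≤ P.d * Real.sqrt P.d * (|(2 * c ^ 2)⁻¹| * CH1) / (ℓ₀ - 3) ^ 3 := by positivity
  have hχ₁T : ∀ z ∈ T, ∀ μ, |χ (z.shift μ) - χ z| ≤ 3 / (2 * ℓ₀) := fun z _ μ => (hχd1 z μ).1
  have hχ₂T : ∀ z ∈ T, ∀ μ, |χ (z.shift μ) + χ (z.unshift μ) - 2 * χ z| ≤ 9 / ℓ₀ ^ 2 := fun z _ μ => hχd2 z μ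
  have hNh := sqrt_sum_sq_weighted_h_le c T χ V g ω hg hC₁0 hC₂0 hD₀0 hD₁0 hΩ0 hχT hχ₁T hχ₂T hV₁T hV₀T hω0' hωT
  have hNht := sqrt_sum_sq_weighted_ht_le c T χ g ω hC₁0 hDg0 hΩ0 hχT hχ₁T hgT hω0' hωT
  have hNs := sqrt_sum_sq_weighted_s_le c T χ g ω hC₁0 hDg'0 hΩ0 hχT hχ₁T hg₁T hω0' hωT
  -- N₂ (brick (S) + brick (N))
  have hN2comm := sum_abs_laplace_mul_le c T χ V g hg hχT hχ₁T hχ₂T hV₁T hV₀T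
  have hRL : 2 * (⌈5 * Real.sqrt P.d * ℓ₀⌉₊ : ℤ) < P.L ^ k * P.sitesPerDir k := by
    rw [hℓ₀, hℓ]; exact near_radius_lt hd k hM
  have hN2near := hCR P hd k hk c b χ g (5 * Real.sqrt P.d * ℓ₀) hχabs hχout hgform hRL
  -- THE BUMP EXTENSION (brick (U) with the package of §1)
  obtain ⟨β, Bβ, rS, hBβ0, hBβ, hrS0, hrS, hβ1, hβ0, hβB, hβS, hdisj⟩ := exists_bump_package (P := P) hk hℓ3n c
  set e : Site P k → Site P 0 := embIter (P := P) k with hedef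
  set a : Site P k → ℝ := fun y => χ (e y) * V (e y) with hadef
  set Y₀ : Finset (Site P k) := Finset.univ.filter fun y => (Site.tdist (e y) b.src : ℝ) < 5 * Real.sqrt P.d * ℓ₀ with hY₀
  set S : Site P k → Finset (Site P 0) := fun y => Finset.univ.filter fun z : Site P 0 => (Site.tdist z (e y) : ℝ) < rS + 1 with hSdef
  set Tu : Finset (Site P 0) := Finset.univ.filter fun z : Site P 0 => (Site.tdist z b.src : ℝ) < 5 * Real.sqrt P.d * ℓ₀ + ℓ + 1 with hTu
  set u : SiteField P 0 ℝ := fun z => ∑ y, a y * β y z with hudef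
  have ha0 : ∀ y ∉ Y₀, a y = 0 := by
    intro y hy
    rw [hY₀, Finset.mem_filter, not_and] at hy
    have := hy (Finset.mem_univ y)
    rw [hadef]; dsimp only
    rw [hχout (e y) (not_lt.mp this), zero_mul]
  have haD : ∀ y, |a y| ≤ CV / (4 * c ^ 4) := by
    intro y; rw [hadef]; dsimp only; rw [abs_mul]
    calc |χ (e y)| * |V (e y)| ≤ 1 * (CV / (4 * c ^ 4)) := mul_le_mul (hχabs _) (hV0 _) (abs_nonneg _) zero_le_one
      _ = CV / (4 * c ^ 4) := one_mul _
  have hBβ' : ∀ y z, |laplace c (β y) z| ≤ 13 * P.d * c ^ 2 * (10 * Real.sqrt P.d + 4) ^ 2 / ℓ ^ 2 := fun y z => (hβB y z).trans hBβ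
  have hdisj' : ∀ y ∈ Y₀, ∀ y' ∈ Y₀, y ≠ y' → Disjoint (S y) (S y') := fun y _ y' _ h => hdisj y y' h
  have hST : ∀ y ∈ Y₀, S y ⊆ Tu := by
    intro y hy z hz
    rw [hY₀, Finset.mem_filter] at hy
    rw [hSdef, Finset.mem_filter] at hz
    rw [hTu, Finset.mem_filter]
    refine ⟨Finset.mem_univ _, ?_⟩
    have htri : (Site.tdist z b.src : ℝ) ≤ Site.tdist z (e y) + Site.tdist (e y) b.src := by exact_mod_cast tdist_triangle _ _ _
    linarith [hz.2, hy.2, hrS]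
  have hu : ∀ x ∈ C, u x = χ x * V x := by
    rintro x ⟨y, rfl⟩
    rw [hudef]; dsimp only
    exact bump_ext_apply_centre a β e hβ1 hβ0 y
  -- its interpolant `U₂` (I-site, by symmetry of `G`)
  have hyc : embIter (P := P) k default ∈ C := ⟨default, rfl⟩
  have hsrc : ∀ x w, w ∉ C → laplace c (laplace c (G x)) w
      = (if w = x then (1 : ℝ) else 0) - (if w = embIter k default then (1 : ℝ) else 0) := by
    intro x w hw
    have eG : G x = fun z => Gf x z - Uf x z := funext fun z => hsplit x z
    rw [eG, laplace_sub', laplace_sub']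
    dsimp only
    rw [hUel x w hw, sub_zero, hGf2 x w]
  obtain ⟨U₂, hU₂C, hU₂el⟩ := exists_pinned_interp_of_green c C G _ hyc hG0 hGrep hsrc u
  -- N₃, N₄ (brick (U))
  set Ωu : ℝ := Real.exp (κ * (1 + (5 * Real.sqrt P.d * ℓ₀ + ℓ + 1) / ℓ)) with hΩu
  have hΩu0 : 0 ≤ Ωu := (Real.exp_pos _).le
  have hωTu : ∀ z ∈ Tu, ω z ≤ Ωu := by
    intro z hz
    rw [hTu, Finset.mem_filter] at hz
    refine (hωhi z).trans (Real.exp_le_exp.mpr (mul_le_mul_of_nonneg_left ?_ hκ0.le))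
    have : (Site.tdist z b.src : ℝ) / ℓ ≤ (5 * Real.sqrt P.d * ℓ₀ + ℓ + 1) / ℓ := div_le_div_of_nonneg_right hz.2.le hℓ0.le
    linarith
  have hBβ'0 : 0 ≤ 13 * P.d * c ^ 2 * (10 * Real.sqrt P.d + 4) ^ 2 / ℓ ^ 2 := by positivity
  have hN3 := sum_abs_laplace_bump_ext_le c a β S Y₀ Tu hD₀0 hBβ'0 ha0 haD (fun y z hz => hβS y z hz) hBβ' hdisj' hST
  have hN4 := sqrt_sum_sq_weighted_laplace_bump_ext_le c a β S Y₀ Tu ω hD₀0 hBβ'0 hΩu0 ha0 haD (fun y z hz => hβS y z hz) hBβ' hdisj' hST hω0' hωTu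
  have hTucard : (Tu.card : ℝ) ≤ ((2 * (⌈5 * Real.sqrt P.d * ℓ₀ + ℓ⌉₊ + 1)) ^ P.d : ℕ) := by
    exact_mod_cast card_filter_tdist_lt_le b.src (5 * Real.sqrt P.d * ℓ₀ + ℓ)
  -- THE POINCARÉ ROW (D1-glob) in root form
  set CG : ℝ := (2197 * (24 * 289 * 24576 * 46116) : ℝ) with hCG
  have hP := poincare_root_of_sq c C (CP := CG / c ^ 4) (ℓ := ℓ) (by positivity)
    (fun v hv => by
      have h := sum_sq_le_laplace_sq_of_vanish_on_range hd hk hc v hv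
      rw [hCG, hℓ]; exact h)
  set A : ℝ := Real.sqrt (CG / c ^ 4) * ℓ ^ 2 with hAdef
  have hA0 : 0 ≤ A := by positivity
  -- `Σω⁻²`
  have hW := sqrt_sum_inv_sq_le b.src ω hκ0 hℓ0 hωlo
  -- ASSEMBLE through the (A-door)
  have hdoor := sum_abs_laplace_sub_interp_le_of_rows c C χ V g f U u U₂ ω
    (a := 2 * κ / ℓ) (b := 4 * κ / ℓ ^ 2) (A := A)
    (by positivity) (by positivity) hA0 hg hf hχf hUC' hUel' hu hU₂C hU₂el hω₀ hω₁ hω₂ hP ha hwin₁ hwin₂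
    (hNh.trans (mul_le_mul_of_nonneg_left (Real.sqrt_le_sqrt hTcard) (by positivity)))
    (hNht.trans (mul_le_mul_of_nonneg_left (Real.sqrt_le_sqrt (mul_le_mul_of_nonneg_left hTcard hd0)) (by positivity)))
    (hNs.trans (mul_le_mul_of_nonneg_left (Real.sqrt_le_sqrt hTcard) (by positivity)))
    hW
    (hN2comm.trans (add_le_add hN2near (mul_le_mul_of_nonneg_right hTcard (by positivity))))
    (hN3.trans (mul_le_mul_of_nonneg_right hTucard (by positivity)))
    (hN4.trans (mul_le_mul_of_nonneg_left (Real.sqrt_le_sqrt hTucard) (by positivity)))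
  -- the left-hand sides agree
  have hlhs : (fun x => (Gf b.tgt x - Gf b.src x) - (Uf b.tgt x - Uf b.src x)) = fun x => V x - U x := rfl
  rw [hlhs]
  exact hdoor

end Summit.QuantumFields.YangMills.Theorems.Prop7PinnedKernelL1Explicit

end
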